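import Summits.BirchSwinnertonDyer.BirchSwinnertonDyer.Theorems.ShaPrimaryTransferFiniteShaComponentTransferSelmerCubicV2Row
import Summits.BirchSwinnertonDyer.BirchSwinnertonDyer.Theorems.ShaPrimaryTransferFiniteShaComponentTransferSelmerCubicV2RRow
import HarnessLib

/-!
# BirchSwinnertonDyer — SEL2CUBIC doors for the KERNEL-2DESC v2.0 rows: the row shapes (`rank_eq_two_of_check[_complSq]`,
# `rank_eq_of_checkLe[_complSq]`, `rank_eq_of_checkR[_complSq]`) as `t₂ = 0` doors

HONEST FRAMING: route `ShaPrimaryTransfer`, seat `bsd-line-spt-p1` (g31), `--supports` item T =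
`FiniteShaComponentTransfer` (stmt-22356), UNCHANGED (conjecture-grade at corank ≥ 2). BSD in rank ≥ 2 is NOT
proved by any of this. THEOREMS ONLY.

The doors `sha_door_of_checkCubic`, `sha_door_of_checkCubicLe`, `sha_door_of_checkCubicR` (`…SelmerCubicV2Row`,
`…SelmerCubicV2RRow`) in the exact argument shapes of the census' per-field plumbing calls
(`FieldM<Δ>.Rows<k>.rank_eq_two_of_row[_complSq]` → `rank_eq_two_of_check[_complSq]`; rank-3 rows → `rank_eq_of_checkLe` /
`rank_eq_of_checkR`), so every row of `Rank2ObservatoryTwoDescRows*` (≈ 10,088 rank-2 curves), `…TwoDescR3Rows*` (325) and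
`…TwoDescR3RRows*` (227) becomes an unconditional `t₂(E) = 0 (∧ Ш[2^∞] = 0) ∧ rank = r` theorem by swapping the name:
`sha_door_of_checkCubic_eq`, `shaCorank_two_eq_zero_of_checkCubic_complSq`, `…checkCubicLe…`, `…checkCubicR…` (+ the
`Δ ≠ 0` extractions). Transport: `…SelmerCubicDoorTransport`. [cite: Cassels1991LecturesEllipticCurves, §15]
[cite: SilvermanAEC2009, Thm. X.4.2, Rem. X.4.1] [cite: CremonaAlgorithms1997, §3.6]
-/

-- single-conjunct summit: `Summit.BirchSwinnertonDyer.BirchSwinnertonDyer.…` repeats the name by design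
set_option linter.dupNamespace false

noncomputable section

open scoped Classical NumberField

open Literature.NumberTheory.NumberFields Literature.NumberTheory.EllipticCurves Polynomial Module NumberField WeierstrassCurve

namespace Summit.BirchSwinnertonDyer.BirchSwinnertonDyer.Theorems.ShaPrimaryTransferSelmerCubicCover

open Summit.BirchSwinnertonDyer.BirchSwinnertonDyer.Rank2Observatory
open Summit.BirchSwinnertonDyer.BirchSwinnertonDyer.Rank2Observatory.TwoDescCubic

section Rows

variable {K : Type} [Field K] [NumberField K] {a b c : ℤ} {α : K}

/-- `Δ ≠ 0` is the first clause of `CurveCert.check`. [folklore] -/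
theorem deltaShort_ne_of_checkCubic {m : ℕ} {lo hi : ℚ} {ucoords : Fin m → ℤ × ℤ × ℤ} {Nu : Fin m → ℤ}
    {su : Fin m → Bool} {cc : CurveCert m}
    (hc : cc.check a b c lo hi ucoords Nu su = true) :
    deltaShort cc.A cc.B cc.C ≠ 0 := by
  simp only [CurveCert.check, Bool.and_eq_true, decide_eq_true_eq] at hc
  exact hc.1.1.1.1.1.1.1.1.1.1.1

/-- **`K`-free door shape for a v2.0 row**, in the exact shape of `rank_eq_two_of_check` (model `(0, A, 0, B, C)` read over
`ℚ` from `ℤ`): the row's arguments unchanged, the theorem name swapped. [cite: Cassels1991LecturesEllipticCurves, §15]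
[cite: CremonaAlgorithms1997, §3.6] -/
theorem sha_door_of_checkCubic_eq [IsPrincipalIdealRing (𝓞 K)]
    (hirr : Irreducible (MonicCubic.polyQ a b c)) (hα : aeval α (MonicCubic.poly a b c) = 0)
    (h3 : finrank ℚ K = 3) {m : ℕ} (Wu : Fin m → (𝓞 K)ˣ)
    (hW : ∀ u : (𝓞 K)ˣ, ∃ T : Finset (Fin m), IsSquare (u * ∏ i ∈ T, Wu i))
    (ucoords : Fin m → ℤ × ℤ × ℤ)
    (hWu : ∀ i, ((Wu i : (𝓞 K)ˣ) : 𝓞 K) = lin hα (ucoords i).1 (ucoords i).2.1 (ucoords i).2.2)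
    {Nu : Fin m → ℤ} (hNu : ∀ i, Algebra.norm ℚ (((Wu i : (𝓞 K)ˣ) : 𝓞 K) : K) = Nu i)
    (ρ : K →+* ℝ) {lo hi : ℚ} (h0 : 0 ≤ lo) (hlo : ((lo : ℚ) : ℝ) < ρ α) (hhi : ρ α < ((hi : ℚ) : ℝ))
    {su : Fin m → Bool} (hsu : ∀ i, (su i = true ↔ ρ (((Wu i : (𝓞 K)ˣ) : 𝓞 K) : K) < 0))
    (cc : CurveCert m)
    (hc : cc.check a b c lo hi ucoords Nu su = true)
    (hprimes : (cc.gens.map GenData.p).Forall Nat.Prime)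
    (hlow : 2 ≤ (((⟨0, cc.A, 0, cc.B, cc.C⟩ : WeierstrassCurve ℤ)).map (Int.castRingHom ℚ)).mordellWeilRank) :
    (((⟨0, cc.A, 0, cc.B, cc.C⟩ : WeierstrassCurve ℤ)).map (Int.castRingHom ℚ)).shaCorank 2 = 0 ∧
      AddCommGroup.primaryComponent (((⟨0, cc.A, 0, cc.B, cc.C⟩ : WeierstrassCurve ℤ)).map (Int.castRingHom ℚ)).sha 2 = ⊥ ∧
        (((⟨0, cc.A, 0, cc.B, cc.C⟩ : WeierstrassCurve ℤ)).map (Int.castRingHom ℚ)).mordellWeilRank = 2 :=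
  sha_door_map_of_door (fun h => sha_door_of_checkCubic hirr hα h3 Wu hW ucoords hWu hNu ρ h0 hlo hhi hsu cc hc hprimes h) hlow

/-- **`t₂(E) = 0 ∧ rank = 2` for the ORIGINAL model** when the row certifies its completed-square model, in the shape of
`rank_eq_two_of_check_complSq`. [cite: CremonaAlgorithms1997, §3.6] [cite: SilvermanAEC2009, III.3.1(b), Thm. X.4.2] -/
theorem shaCorank_two_eq_zero_of_checkCubic_complSq [IsPrincipalIdealRing (𝓞 K)]
    (hirr : Irreducible (MonicCubic.polyQ a b c)) (hα : aeval α (MonicCubic.poly a b c) = 0)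
    (h3 : finrank ℚ K = 3) {m : ℕ} (Wu : Fin m → (𝓞 K)ˣ)
    (hW : ∀ u : (𝓞 K)ˣ, ∃ T : Finset (Fin m), IsSquare (u * ∏ i ∈ T, Wu i))
    (ucoords : Fin m → ℤ × ℤ × ℤ)
    (hWu : ∀ i, ((Wu i : (𝓞 K)ˣ) : 𝓞 K) = lin hα (ucoords i).1 (ucoords i).2.1 (ucoords i).2.2)
    {Nu : Fin m → ℤ} (hNu : ∀ i, Algebra.norm ℚ (((Wu i : (𝓞 K)ˣ) : 𝓞 K) : K) = Nu i)
    (ρ : K →+* ℝ) {lo hi : ℚ} (h0 : 0 ≤ lo) (hlo : ((lo : ℚ) : ℝ) < ρ α) (hhi : ρ α < ((hi : ℚ) : ℝ))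
    {su : Fin m → Bool} (hsu : ∀ i, (su i = true ↔ ρ (((Wu i : (𝓞 K)ˣ) : 𝓞 K) : K) < 0))
    (cc : CurveCert m)
    (hc : cc.check a b c lo hi ucoords Nu su = true)
    (hprimes : (cc.gens.map GenData.p).Forall Nat.Prime) (a₁ a₂ a₃ a₄ a₆ : ℤ)
    (hABC : cc.A = a₁ ^ 2 + 4 * a₂ ∧ cc.B = 8 * (a₁ * a₃ + 2 * a₄) ∧ cc.C = 16 * (a₃ ^ 2 + 4 * a₆))
    (hlow : 2 ≤ (((⟨a₁, a₂, a₃, a₄, a₆⟩ : WeierstrassCurve ℤ)).map (Int.castRingHom ℚ)).mordellWeilRank) :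
    (((⟨a₁, a₂, a₃, a₄, a₆⟩ : WeierstrassCurve ℤ)).map (Int.castRingHom ℚ)).shaCorank 2 = 0 ∧
      (((⟨a₁, a₂, a₃, a₄, a₆⟩ : WeierstrassCurve ℤ)).map (Int.castRingHom ℚ)).mordellWeilRank = 2 :=
  shaCorank_two_transport_complSq a₁ a₂ a₃ a₄ a₆ hABC (deltaShort_ne_of_checkCubic hc)
    (fun h => sha_door_of_checkCubic hirr hα h3 Wu hW ucoords hWu hNu ρ h0 hlo hhi hsu cc hc hprimes h) hlow

/-- `Δ ≠ 0` is the first clause of `CurveCert.checkLe`. [folklore] -/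
theorem deltaShort_ne_of_checkCubicLe (r : ℕ) {m : ℕ} {lo hi : ℚ} {ucoords : Fin m → ℤ × ℤ × ℤ} {Nu : Fin m → ℤ}
    {su : Fin m → Bool} {cc : CurveCert m}
    (hc : cc.checkLe r a b c lo hi ucoords Nu su = true) :
    deltaShort cc.A cc.B cc.C ≠ 0 := by
  simp only [CurveCert.checkLe, Bool.and_eq_true, decide_eq_true_eq] at hc
  exact hc.1.1.1.1.1.1.1.1.1.1.1

/-- **`K`-free door shape for a v2.0 row**, in the exact shape of `rank_eq_of_checkLe` (model `(0, A, 0, B, C)` read over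
`ℚ` from `ℤ`): the row's arguments unchanged, the theorem name swapped. [cite: Cassels1991LecturesEllipticCurves, §15]
[cite: CremonaAlgorithms1997, §3.6] -/
theorem sha_door_of_checkCubicLe_eq (r : ℕ) [IsPrincipalIdealRing (𝓞 K)]
    (hirr : Irreducible (MonicCubic.polyQ a b c)) (hα : aeval α (MonicCubic.poly a b c) = 0)
    (h3 : finrank ℚ K = 3) {m : ℕ} (Wu : Fin m → (𝓞 K)ˣ)
    (hW : ∀ u : (𝓞 K)ˣ, ∃ T : Finset (Fin m), IsSquare (u * ∏ i ∈ T, Wu i))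
    (ucoords : Fin m → ℤ × ℤ × ℤ)
    (hWu : ∀ i, ((Wu i : (𝓞 K)ˣ) : 𝓞 K) = lin hα (ucoords i).1 (ucoords i).2.1 (ucoords i).2.2)
    {Nu : Fin m → ℤ} (hNu : ∀ i, Algebra.norm ℚ (((Wu i : (𝓞 K)ˣ) : 𝓞 K) : K) = Nu i)
    (ρ : K →+* ℝ) {lo hi : ℚ} (h0 : 0 ≤ lo) (hlo : ((lo : ℚ) : ℝ) < ρ α) (hhi : ρ α < ((hi : ℚ) : ℝ))
    {su : Fin m → Bool} (hsu : ∀ i, (su i = true ↔ ρ (((Wu i : (𝓞 K)ˣ) : 𝓞 K) : K) < 0))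
    (cc : CurveCert m)
    (hc : cc.checkLe r a b c lo hi ucoords Nu su = true)
    (hprimes : (cc.gens.map GenData.p).Forall Nat.Prime)
    (hlow : r ≤ (((⟨0, cc.A, 0, cc.B, cc.C⟩ : WeierstrassCurve ℤ)).map (Int.castRingHom ℚ)).mordellWeilRank) :
    (((⟨0, cc.A, 0, cc.B, cc.C⟩ : WeierstrassCurve ℤ)).map (Int.castRingHom ℚ)).shaCorank 2 = 0 ∧
      AddCommGroup.primaryComponent (((⟨0, cc.A, 0, cc.B, cc.C⟩ : WeierstrassCurve ℤ)).map (Int.castRingHom ℚ)).sha 2 = ⊥ ∧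
        (((⟨0, cc.A, 0, cc.B, cc.C⟩ : WeierstrassCurve ℤ)).map (Int.castRingHom ℚ)).mordellWeilRank = r :=
  sha_door_map_of_door (fun h => sha_door_of_checkCubicLe r hirr hα h3 Wu hW ucoords hWu hNu ρ h0 hlo hhi hsu cc hc hprimes h) hlow

/-- **`t₂(E) = 0 ∧ rank = r` for the ORIGINAL model** when the row certifies its completed-square model, in the shape of
`rank_eq_of_checkLe_complSq`. [cite: CremonaAlgorithms1997, §3.6] [cite: SilvermanAEC2009, III.3.1(b), Thm. X.4.2] -/
theorem shaCorank_two_eq_zero_of_checkCubicLe_complSq (r : ℕ) [IsPrincipalIdealRing (𝓞 K)]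
    (hirr : Irreducible (MonicCubic.polyQ a b c)) (hα : aeval α (MonicCubic.poly a b c) = 0)
    (h3 : finrank ℚ K = 3) {m : ℕ} (Wu : Fin m → (𝓞 K)ˣ)
    (hW : ∀ u : (𝓞 K)ˣ, ∃ T : Finset (Fin m), IsSquare (u * ∏ i ∈ T, Wu i))
    (ucoords : Fin m → ℤ × ℤ × ℤ)
    (hWu : ∀ i, ((Wu i : (𝓞 K)ˣ) : 𝓞 K) = lin hα (ucoords i).1 (ucoords i).2.1 (ucoords i).2.2)
    {Nu : Fin m → ℤ} (hNu : ∀ i, Algebra.norm ℚ (((Wu i : (𝓞 K)ˣ) : 𝓞 K) : K) = Nu i)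
    (ρ : K →+* ℝ) {lo hi : ℚ} (h0 : 0 ≤ lo) (hlo : ((lo : ℚ) : ℝ) < ρ α) (hhi : ρ α < ((hi : ℚ) : ℝ))
    {su : Fin m → Bool} (hsu : ∀ i, (su i = true ↔ ρ (((Wu i : (𝓞 K)ˣ) : 𝓞 K) : K) < 0))
    (cc : CurveCert m)
    (hc : cc.checkLe r a b c lo hi ucoords Nu su = true)
    (hprimes : (cc.gens.map GenData.p).Forall Nat.Prime) (a₁ a₂ a₃ a₄ a₆ : ℤ)
    (hABC : cc.A = a₁ ^ 2 + 4 * a₂ ∧ cc.B = 8 * (a₁ * a₃ + 2 * a₄) ∧ cc.C = 16 * (a₃ ^ 2 + 4 * a₆))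
    (hlow : r ≤ (((⟨a₁, a₂, a₃, a₄, a₆⟩ : WeierstrassCurve ℤ)).map (Int.castRingHom ℚ)).mordellWeilRank) :
    (((⟨a₁, a₂, a₃, a₄, a₆⟩ : WeierstrassCurve ℤ)).map (Int.castRingHom ℚ)).shaCorank 2 = 0 ∧
      (((⟨a₁, a₂, a₃, a₄, a₆⟩ : WeierstrassCurve ℤ)).map (Int.castRingHom ℚ)).mordellWeilRank = r :=
  shaCorank_two_transport_complSq a₁ a₂ a₃ a₄ a₆ hABC (deltaShort_ne_of_checkCubicLe r hc)
    (fun h => sha_door_of_checkCubicLe r hirr hα h3 Wu hW ucoords hWu hNu ρ h0 hlo hhi hsu cc hc hprimes h) hlow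

/-- `Δ ≠ 0` is the first clause of `CurveCertR.checkR`. [folklore] -/
theorem deltaShort_ne_of_checkCubicR (r : ℕ) {m : ℕ} {I : Fin 3 → ℚ × ℚ} {ucoords : Fin m → ℤ × ℤ × ℤ} {Nu : Fin m → ℤ}
    {su : Fin 3 → Fin m → Bool} {cc : CurveCertR m}
    (hc : cc.checkR r a b c I ucoords Nu su = true) :
    deltaShort cc.A cc.B cc.C ≠ 0 := by
  simp only [CurveCertR.checkR, Bool.and_eq_true, decide_eq_true_eq] at hc
  exact hc.1.1.1.1.1.1.1.1.1.1.1

/-- **`K`-free door shape for a v2.0 row**, in the exact shape of `rank_eq_of_checkR` (model `(0, A, 0, B, C)` read over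
`ℚ` from `ℤ`): the row's arguments unchanged, the theorem name swapped. [cite: Cassels1991LecturesEllipticCurves, §15]
[cite: CremonaAlgorithms1997, §3.6] -/
theorem sha_door_of_checkCubicR_eq (r : ℕ) [IsPrincipalIdealRing (𝓞 K)]
    (hirr : Irreducible (MonicCubic.polyQ a b c)) (hα : aeval α (MonicCubic.poly a b c) = 0)
    (h3 : finrank ℚ K = 3) {m : ℕ} (Wu : Fin m → (𝓞 K)ˣ)
    (hW : ∀ u : (𝓞 K)ˣ, ∃ T : Finset (Fin m), IsSquare (u * ∏ i ∈ T, Wu i))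
    (ucoords : Fin m → ℤ × ℤ × ℤ)
    (hWu : ∀ i, ((Wu i : (𝓞 K)ˣ) : 𝓞 K) = lin hα (ucoords i).1 (ucoords i).2.1 (ucoords i).2.2)
    {Nu : Fin m → ℤ} (hNu : ∀ i, Algebra.norm ℚ (((Wu i : (𝓞 K)ˣ) : 𝓞 K) : K) = Nu i)
    (ρ : Fin 3 → (K →+* ℝ)) {I : Fin 3 → ℚ × ℚ} (h0 : ∀ k, 0 ≤ (I k).1)
    (hlo : ∀ k, (((I k).1 : ℚ) : ℝ) < ρ k α) (hhi : ∀ k, ρ k α < (((I k).2 : ℚ) : ℝ))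
    {su : Fin 3 → Fin m → Bool} (hsu : ∀ k i, (su k i = true ↔ ρ k (((Wu i : (𝓞 K)ˣ) : 𝓞 K) : K) < 0))
    (cc : CurveCertR m)
    (hc : cc.checkR r a b c I ucoords Nu su = true)
    (hprimes : (cc.gens.map GenDataR.p).Forall Nat.Prime)
    (hlow : r ≤ (((⟨0, cc.A, 0, cc.B, cc.C⟩ : WeierstrassCurve ℤ)).map (Int.castRingHom ℚ)).mordellWeilRank) :
    (((⟨0, cc.A, 0, cc.B, cc.C⟩ : WeierstrassCurve ℤ)).map (Int.castRingHom ℚ)).shaCorank 2 = 0 ∧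
      AddCommGroup.primaryComponent (((⟨0, cc.A, 0, cc.B, cc.C⟩ : WeierstrassCurve ℤ)).map (Int.castRingHom ℚ)).sha 2 = ⊥ ∧
        (((⟨0, cc.A, 0, cc.B, cc.C⟩ : WeierstrassCurve ℤ)).map (Int.castRingHom ℚ)).mordellWeilRank = r :=
  sha_door_map_of_door (fun h => sha_door_of_checkCubicR r hirr hα h3 Wu hW ucoords hWu hNu ρ h0 hlo hhi hsu cc hc hprimes h) hlow

/-- **`t₂(E) = 0 ∧ rank = r` for the ORIGINAL model** when the row certifies its completed-square model, in the shape of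
`rank_eq_of_checkR_complSq`. [cite: CremonaAlgorithms1997, §3.6] [cite: SilvermanAEC2009, III.3.1(b), Thm. X.4.2] -/
theorem shaCorank_two_eq_zero_of_checkCubicR_complSq (r : ℕ) [IsPrincipalIdealRing (𝓞 K)]
    (hirr : Irreducible (MonicCubic.polyQ a b c)) (hα : aeval α (MonicCubic.poly a b c) = 0)
    (h3 : finrank ℚ K = 3) {m : ℕ} (Wu : Fin m → (𝓞 K)ˣ)
    (hW : ∀ u : (𝓞 K)ˣ, ∃ T : Finset (Fin m), IsSquare (u * ∏ i ∈ T, Wu i))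
    (ucoords : Fin m → ℤ × ℤ × ℤ)
    (hWu : ∀ i, ((Wu i : (𝓞 K)ˣ) : 𝓞 K) = lin hα (ucoords i).1 (ucoords i).2.1 (ucoords i).2.2)
    {Nu : Fin m → ℤ} (hNu : ∀ i, Algebra.norm ℚ (((Wu i : (𝓞 K)ˣ) : 𝓞 K) : K) = Nu i)
    (ρ : Fin 3 → (K →+* ℝ)) {I : Fin 3 → ℚ × ℚ} (h0 : ∀ k, 0 ≤ (I k).1)
    (hlo : ∀ k, (((I k).1 : ℚ) : ℝ) < ρ k α) (hhi : ∀ k, ρ k α < (((I k).2 : ℚ) : ℝ))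
    {su : Fin 3 → Fin m → Bool} (hsu : ∀ k i, (su k i = true ↔ ρ k (((Wu i : (𝓞 K)ˣ) : 𝓞 K) : K) < 0))
    (cc : CurveCertR m)
    (hc : cc.checkR r a b c I ucoords Nu su = true)
    (hprimes : (cc.gens.map GenDataR.p).Forall Nat.Prime) (a₁ a₂ a₃ a₄ a₆ : ℤ)
    (hABC : cc.A = a₁ ^ 2 + 4 * a₂ ∧ cc.B = 8 * (a₁ * a₃ + 2 * a₄) ∧ cc.C = 16 * (a₃ ^ 2 + 4 * a₆))
    (hlow : r ≤ (((⟨a₁, a₂, a₃, a₄, a₆⟩ : WeierstrassCurve ℤ)).map (Int.castRingHom ℚ)).mordellWeilRank) :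
    (((⟨a₁, a₂, a₃, a₄, a₆⟩ : WeierstrassCurve ℤ)).map (Int.castRingHom ℚ)).shaCorank 2 = 0 ∧
      (((⟨a₁, a₂, a₃, a₄, a₆⟩ : WeierstrassCurve ℤ)).map (Int.castRingHom ℚ)).mordellWeilRank = r :=
  shaCorank_two_transport_complSq a₁ a₂ a₃ a₄ a₆ hABC (deltaShort_ne_of_checkCubicR r hc)
    (fun h => sha_door_of_checkCubicR r hirr hα h3 Wu hW ucoords hWu hNu ρ h0 hlo hhi hsu cc hc hprimes h) hlow

end Rows

end Summit.BirchSwinnertonDyer.BirchSwinnertonDyer.Theorems.ShaPrimaryTransferSelmerCubicCover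

end
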